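/-
Copyright (c) 2026 the pub-hodgecm-mathlib formalisation cell (harness21).  Prover seat hodgecm-mathlib-LH7-p09 (g3), CLOSE-OUT ROSTER strike line L3∕L5 (Track A
«(D-RAM) FOUR-FRAME» squad F0∕P3c∕LH4 ∕ F0∕P3c∕LH7); β₂ WORD #30∕#34∕#36 «LH7-p09: hL_mix_hi» (lower line at `d ≤ b`); helper lane on h413 = stmt-HodgeConjecture-24833
(count-neutral).  2026-09-05.
-/
import Summits.HodgeConjecture.HodgeConjecture.Theorems.F0P3cDyRamUpperRayDigitConstancy   -- ★ p864601 (LH4-p19 (g3)): `litStar_iff_of_near` (scale `|ϖ|^{2d−1}`), `sphere_iff_of_near`, `psi_iff_of_near`; brings ★ Lit `normSign_eq_of_near`, `IsRamifiedQuadraticDatum`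
import HarnessLib

/-!
# Crux `H413`, line LH4 «(D-RAM) FOUR-FRAME» — STAGE-1b, row (2), the (β₂) road (R-36), (OFF) residue, LOWER line: «DIGIT CONSTANCY ONE DIGIT DEEPER» — the literal
# predicate `LIT⋆(V) = (|κ̂(V)|·|cA| = |ϖE|^b ∧ κ̂ρκ̂∕(hρh) ∈ N_Θ(Fix ρ))`, `κ̂(V) = κ₀ + jE V·ξ₀`, does not move when the fixed digit `V` moves by `|ϖ|^{2d−2}`, PROVIDED the
# cell's digit sphere is LARGE (`|κ̂| = |ξ₀| ≥ |ϖ|^{−1}`: strictly below the diagonal, `b < j`) and `|2| ≤ |ϖ|` (dyadic)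

Cell `hodgecm-mathlib` (D-0151), FLOOR 0, crux item H413 = `stmt-HodgeConjecture-24833`, route of record `HCCMUnconditional`; squad F0∕P3c∕LH4 ∕ LH7; lane
`--supports stmt-HodgeConjecture-24833 --as helper` (count-neutral; pays NO tier-0 row).  THEOREMS ONLY (no `def`, no instance, no notation, no `sorry`, default heartbeats);
★-only imports; states NO law; (β₂) stays a HYPOTHESIS.  Frame = ★ p864601's §1 (`jE`-letters, `ρ ∘ ρ = 1`, `ρ` isometric, `Θρ = ρΘ`; reference pair `κ₀, ξ₀` with
`κ₀ + ρκ₀ = 1`, `Θκ₀ = κ₀`, `ρξ₀ = −ξ₀`, `Θξ₀ = ξ₀ ≠ 0`; `|ξ₀|·|cA| = |jEϖ|^b`; the norm letter `hdeep` at depth `2d − 1`) + the two LOWER-LINE letters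
`hbig : 1 ≤ |jEϖ|·|ξ₀|` and `h2 : |2| ≤ |jEϖ|`, and `2 ≤ d`.

WHY (β₂ sub-dealer LH4-p04 (g10) 02:08:26Z (b): road A = LH4-p19 (g3)'s R2 worker with `hdb : d ≤ b` pays `hL_ray` AND ‹HL_MIX_HI›∕‹PRODBAL-L›).  The count socket ★ p864098
takes (hbase) from ★ F1 `…SphereLabelDigits.card_filter_sphere_plus_eq_card_filter_not`, whose side condition `C` (the literal predicate) must be constant along the sphere's
`U_F^{(d−1)}`-cosets `|γ₁(V′ − V)| ≤ e^{−2(d−1)}`.  On an upper-line RAY cell `|γ₁| ≥ |ϖ|^{−1}`-ish and ★ p864601 `litStar_iff_of_near` (`|V′ − V| ≤ |ϖ|^{2d−1}`) serves; on the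
LOWER line `|γ₁| = |cA|·|ξ₀|·|ϖE|^{−b} = 1`, so `C`'s coset is `|V′ − V| ≤ |ϖ|^{2d−2}` — ONE DIGIT SHORT for ★ p864601's proof (`|w − 1| ≤ |η|·|ρκ̂ − κ̂|∕|κ̂|² ≤ |η|∕|κ̂|`).
The missing digit is in the cell: `ρκ̂ = 1 − κ̂` (`Tr_ρ κ₀ = 1`, `ξ₀` anti), so `|ρκ̂ − κ̂| = |1 − 2κ̂| ≤ max(1, |2|·|κ̂|) ≤ |ϖ|·|κ̂|` once `|κ̂| ≥ |ϖ|^{−1}` (the lower line's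
`|κ̂| = R = |ϖ|^{b−j} > 1`) and `|2| ≤ |ϖ|`; and `|η|² ≤ |ϖ|^{4d−4}|κ̂|² ≤ |ϖ|^{2d−1}|κ̂|²` for `d ≥ 2`.  Hence `|w − 1| ≤ |ϖ|^{2d−1}` again, `w ∈ N_Θ(Fix ρ)` by `hdeep`, and
`LIT⋆` is constant at the lower-line scale.
* §1 `v_one_sub_two_mul_le` (the digit: `|1 − 2κ| ≤ |ϖM|·|κ|` for `1 ≤ |ϖM|·|κ|`, `|2| ≤ |ϖM|`); §2 `litStar_of_near_of_big` (one direction), HEAD `litStar_iff_of_near_of_big`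
  (★ p864601 §1's binders VERBATIM minus `hlt`, plus `hbig h2 hd2`, `hnear` at `2d − 2`; conclusion char-equal).
WHAT IS NOT CLAIMED: the reference pair's normalisation on the lower line, `|γ₁| = 1`, (hbase) itself, any count.
HONEST LABEL.  Count-neutral valuation algebra; nothing printed is asserted; no census law is stated; `hL_ray`, ‹HL_MIX_HI›, ‹PRODBAL-L› stay OPEN; `HC_CM` is proved only modulo the
7 printed citations (2 remaining named inputs: hLiu418 = `stmt-HodgeConjecture-24832`, h413 = `stmt-HodgeConjecture-24833`) until rung 0 closes.
## References
* [Serre1979] J.-P. Serre, *Local Fields*, GTM 67 (1979): Ch. V §3 Cor. 3 pp. 85–87 (`U^{(n)} ⊆ N` for `n ≥ 2d − 1`; conductor of `ω`), Ch. XV §2.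
* [Rogawski1990] J. D. Rogawski, *Automorphic Representations of Unitary Groups in Three Variables*, Ann. of Math. Stud. 123 (1990): §4.9 Prop. 4.9.1 (b) p. 55.
* [Kottwitz1986BaseChangeUnits] R. E. Kottwitz, *Base change for unit elements of Hecke algebras*, Compositio Math. 60 (1986): §3 (the digit fibration of a cone cell).
-/

set_option autoImplicit false

noncomputable section

namespace Summit.HodgeConjecture.HodgeConjecture.Cruxes.H413.F0P3cDyRamLowerLineDigitConstancy

open scoped Valued WithZero
open WithZero
open Literature.NumberTheory.Automorphic.UnitaryThreeFourFrame (IsRamifiedQuadraticDatum)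

variable {E M : Type} [Field E] [Valued E ℤᵐ⁰] [Field M] [Valued M ℤᵐ⁰] {ρ Θ : M →+* M}

/-! ## §1 The extra digit: `|1 − 2κ| ≤ |ϖM|·|κ|` on a large sphere -/
omit [Valued E ℤᵐ⁰] in
/-- **THE EXTRA DIGIT OF THE LOWER LINE**: `1 ≤ |ϖM|·|κ|` and `|2| ≤ |ϖM|` ⟹ `|1 − 2κ| ≤ |ϖM|·|κ|` (ultrametric: `|1| = 1 ≤ |ϖM||κ|`, `|2κ| ≤ |ϖM||κ|`).
[cite: Serre1979, Ch. V §3 Cor. 3 pp. 85–87] -/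
theorem v_one_sub_two_mul_le {ϖM κ : M} (hbig : 1 ≤ Valued.v ϖM * Valued.v κ) (h2 : Valued.v (2 : M) ≤ Valued.v ϖM) :
    Valued.v (1 - 2 * κ) ≤ Valued.v ϖM * Valued.v κ := by
  refine (Valuation.map_sub _ _ _).trans (max_le ?_ ?_)
  · rwa [Valuation.map_one]
  · rw [Valuation.map_mul]; exact mul_le_mul' h2 le_rfl

/-! ## §2 `LIT⋆` is constant on `|ϖ|^{2d−2}`-balls of fixed digits when the sphere is large -/

/-- **ONE DIRECTION OF THE HEAD** (the statement is symmetric in `V, V′`): `LIT⋆ V → LIT⋆ V′` for fixed digits `V, V′` with `|V′ − V| ≤ |ϖ|^{2d−2}`, given ★ p864601 §1's letters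
(reference pair, `|ξ₀|·|cA| = |jEϖ|^b`, `hdeep` at depth `2d − 1`) and the lower-line letters `1 ≤ |jEϖ|·|ξ₀|`, `|2| ≤ |jEϖ|`, `2 ≤ d`.  (`κ̂′ = κ̂ + η`, `|η| ≤ |ϖ|^{2d−2}|κ̂| < |κ̂|`;
`w = κ̂′ρκ̂′∕(κ̂ρκ̂)`, `w − 1 = (η(ρκ̂ − κ̂) − η²)∕(κ̂ρκ̂)`, `ρκ̂ − κ̂ = 1 − 2κ̂` of size `≤ |ϖ||κ̂|` (§1) ⟹ `|w − 1| ≤ |ϖ|^{2d−1}` ⟹ `w ∈ N_Θ(Fix ρ)`.)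
[cite: Serre1979, Ch. V §3 Cor. 3 pp. 85–87] [cite: Rogawski1990, §4.9 Prop. 4.9.1 (b) p. 55] [cite: Kottwitz1986BaseChangeUnits, §3] -/
theorem litStar_of_near_of_big {σ : E →+* E} {ϖ : E} {d : ℕ}
    (jE : E →+* M) (hjiso : ∀ a, Valued.v (jE a) = Valued.v a) (hjfix : ∀ z, ρ z = z ↔ ∃ c, jE c = z) (hΘj : ∀ c, Θ (jE c) = jE (σ c))
    (hρρ : ∀ x, ρ (ρ x) = x) (hvρ : ∀ x, Valued.v (ρ x) = Valued.v x) (hΘρ : ∀ x, Θ (ρ x) = ρ (Θ x))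
    {κ₀ ξ₀ : M} (hκ₀ : κ₀ + ρ κ₀ = 1) (hΘκ₀ : Θ κ₀ = κ₀) (hξ : ρ ξ₀ = -ξ₀) (hΘξ : Θ ξ₀ = ξ₀) (hξ0 : ξ₀ ≠ 0)
    {cA hM : M} {b : ℕ} (hRe : Valued.v ξ₀ * Valued.v cA = Valued.v (jE ϖ) ^ b) (hϖ0 : jE ϖ ≠ 0)
    (hdeep : ∀ u : M, ρ u = u → Θ u = u → Valued.v (u - 1) ≤ Valued.v (jE ϖ) ^ (2 * d - 1) → ∃ c : M, ρ c = c ∧ c * Θ c = u)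
    (hbig : 1 ≤ Valued.v (jE ϖ) * Valued.v ξ₀) (h2 : Valued.v (2 : M) ≤ Valued.v (jE ϖ)) (hd2 : 2 ≤ d) (hϖlt : Valued.v ϖ < 1)
    {V V' : E} (hσV : σ V = V) (hσV' : σ V' = V') (hnear : Valued.v (V' - V) ≤ Valued.v ϖ ^ (2 * d - 2))
    (hL : Valued.v (κ₀ + jE V * ξ₀) * Valued.v cA = Valued.v (jE ϖ) ^ b ∧
      ∃ e : M, ρ e = e ∧ e * Θ e = (κ₀ + jE V * ξ₀) * ρ (κ₀ + jE V * ξ₀) / (hM * ρ hM)) :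
    Valued.v (κ₀ + jE V' * ξ₀) * Valued.v cA = Valued.v (jE ϖ) ^ b ∧
      ∃ e : M, ρ e = e ∧ e * Θ e = (κ₀ + jE V' * ξ₀) * ρ (κ₀ + jE V' * ξ₀) / (hM * ρ hM) := by
  obtain ⟨hLv, e, hρe, he⟩ := hL
  have hρj : ∀ c : E, ρ (jE c) = jE c := fun c => (hjfix _).2 ⟨c, rfl⟩
  have hjϖv : Valued.v (jE ϖ) = Valued.v ϖ := hjiso ϖ
  have hcA0 : Valued.v cA ≠ 0 := fun h0 => by
    rw [h0, mul_zero] at hRe; exact pow_ne_zero _ ((Valuation.ne_zero_iff _).2 hϖ0) hRe.symm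
  set κ : M := κ₀ + jE V * ξ₀ with hκdef
  set η : M := jE (V' - V) * ξ₀ with hηdef
  have hκ' : κ₀ + jE V' * ξ₀ = κ + η := by rw [hκdef, hηdef, map_sub]; ring
  -- sizes: `|κ| = |ξ₀|`, `|η| ≤ |ϖ|^{2d−2}·|κ| < |κ|`
  have hκv : Valued.v κ = Valued.v ξ₀ := mul_right_cancel₀ hcA0 (hLv.trans hRe.symm)
  have hξpos : (0 : ℤᵐ⁰) < Valued.v ξ₀ := zero_lt_iff.2 ((Valuation.ne_zero_iff _).2 hξ0)
  have hηv : Valued.v η ≤ Valued.v (jE ϖ) ^ (2 * d - 2) * Valued.v κ := by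
    rw [hηdef, Valuation.map_mul, hκv, hjiso, hjϖv]; exact mul_le_mul' hnear le_rfl
  have hpow_lt : Valued.v (jE ϖ) ^ (2 * d - 2) < 1 := by rw [hjϖv]; exact pow_lt_one₀ zero_le hϖlt (by omega)
  have hηlt : Valued.v η < Valued.v κ := by
    refine hηv.trans_lt ?_
    calc Valued.v (jE ϖ) ^ (2 * d - 2) * Valued.v κ < 1 * Valued.v κ := by
          rw [hκv]; exact mul_lt_mul_of_pos_right hpow_lt hξpos
      _ = Valued.v κ := one_mul _
  have hκ0 : κ ≠ 0 := fun h0 => by rw [h0, map_zero] at hκv; exact hξ0 ((Valuation.zero_iff _).1 hκv.symm)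
  have hρκ : ρ κ = 1 - κ := by
    rw [hκdef, map_add, map_mul, hρj, hξ, mul_neg, ← hκ₀]; ring
  have hρκ0 : ρ κ ≠ 0 := fun h0 => hκ0 (by rw [← hρρ κ, h0, map_zero])
  have hρη : ρ η = -η := by rw [hηdef, map_mul, hρj, hξ, mul_neg]
  have hΘκ : Θ κ = κ := by rw [hκdef, map_add, map_mul, hΘκ₀, hΘj, hσV, hΘξ]
  have hΘη : Θ η = η := by rw [hηdef, map_mul, hΘj, map_sub, hσV, hσV', hΘξ, map_sub]
  -- the lower line's extra digit: `|ρκ − κ| = |1 − 2κ| ≤ |ϖ|·|κ|`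
  have hskew : Valued.v (ρ κ - κ) ≤ Valued.v (jE ϖ) * Valued.v κ := by
    rw [hρκ, show (1 : M) - κ - κ = 1 - 2 * κ by ring]
    exact v_one_sub_two_mul_le (by rw [hκv]; exact hbig) h2
  -- the twist `w = κ′ρκ′ ∕ (κρκ)`
  set w : M := (κ + η) * ρ (κ + η) / (κ * ρ κ) with hwdef
  have hρw : ρ w = w := by
    rw [hwdef, map_div₀, map_mul, map_mul, hρρ, hρρ]; ring
  have hΘw : Θ w = w := by
    rw [hwdef, map_div₀, map_mul, map_mul, hΘρ, hΘρ, map_add, hΘκ, hΘη]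
  have hw1 : w - 1 = (η * (ρ κ - κ) - η * η) / (κ * ρ κ) := by
    rw [hwdef, map_add, hρη]; field_simp; ring
  have hwv : Valued.v (w - 1) ≤ Valued.v (jE ϖ) ^ (2 * d - 1) := by
    rw [hw1, Valuation.map_div, Valuation.map_mul, hvρ]
    have hκpos : (0 : ℤᵐ⁰) < Valued.v κ * Valued.v κ := mul_pos (hκv ▸ hξpos) (hκv ▸ hξpos)
    rw [div_le_iff₀ hκpos]
    have hexp : Valued.v (jE ϖ) ^ (2 * d - 2) * Valued.v (jE ϖ) = Valued.v (jE ϖ) ^ (2 * d - 1) := by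
      rw [← pow_succ, show 2 * d - 2 + 1 = 2 * d - 1 by omega]
    have h1 : Valued.v (η * (ρ κ - κ)) ≤ Valued.v (jE ϖ) ^ (2 * d - 1) * (Valued.v κ * Valued.v κ) := by
      rw [Valuation.map_mul]
      calc Valued.v η * Valued.v (ρ κ - κ) ≤ Valued.v (jE ϖ) ^ (2 * d - 2) * Valued.v κ * (Valued.v (jE ϖ) * Valued.v κ) := mul_le_mul' hηv hskew
        _ = Valued.v (jE ϖ) ^ (2 * d - 2) * Valued.v (jE ϖ) * (Valued.v κ * Valued.v κ) := by ac_rfl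
        _ = Valued.v (jE ϖ) ^ (2 * d - 1) * (Valued.v κ * Valued.v κ) := by rw [hexp]
    have h2' : Valued.v (η * η) ≤ Valued.v (jE ϖ) ^ (2 * d - 1) * (Valued.v κ * Valued.v κ) := by
      rw [Valuation.map_mul]
      have hjϖ1 : Valued.v (jE ϖ) ≤ 1 := by rw [hjϖv]; exact hϖlt.le
      calc Valued.v η * Valued.v η ≤ Valued.v (jE ϖ) ^ (2 * d - 2) * Valued.v κ * (Valued.v (jE ϖ) ^ (2 * d - 2) * Valued.v κ) := mul_le_mul' hηv hηv
        _ = Valued.v (jE ϖ) ^ (2 * d - 2 + (2 * d - 2)) * (Valued.v κ * Valued.v κ) := by rw [pow_add]; ac_rfl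
        _ ≤ Valued.v (jE ϖ) ^ (2 * d - 1) * (Valued.v κ * Valued.v κ) :=
          mul_le_mul' (pow_le_pow_right_of_le_one' hjϖ1 (by omega)) le_rfl
    exact (Valuation.map_sub _ _ _).trans (max_le h1 h2')
  obtain ⟨c, hρc, hc⟩ := hdeep w hρw hΘw hwv
  refine ⟨?_, c * e, by rw [map_mul, hρc, hρe], ?_⟩
  · rw [hκ', Valuation.map_add_eq_of_lt_left _ hηlt]; exact hLv
  · have hcc : c * e * Θ (c * e) = w * ((κ + η - η) * ρ (κ + η - η) / (hM * ρ hM)) := by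
      rw [map_mul, add_sub_cancel_right, ← he, ← hc]; ring
    rw [hcc, hκ', hwdef, add_sub_cancel_right]
    field_simp

/-- **HEAD — «ON THE LOWER LINE `LIT⋆` IS CONSTANT ON `|ϖ|^{2d−2}`-BALLS OF FIXED DIGITS».**  ★ p864601 §1's letters (`jE`-letters, `ρ ∘ ρ = 1`, `ρ` isometric, `Θρ = ρΘ`; the
reference pair `κ₀, ξ₀`; `|ξ₀|·|cA| = |jEϖ|^b`; the norm letter `hdeep` at depth `2d − 1`) + `1 ≤ |jEϖ|·|ξ₀|` (large sphere, `b < j`), `|2| ≤ |jEϖ|` (dyadic), `2 ≤ d`, `|ϖ| < 1`.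
THEN for fixed `V, V′` with `|V′ − V| ≤ |ϖ|^{2d−2}`: `LIT⋆ V ↔ LIT⋆ V′`, `LIT⋆ V :≡ |κ₀ + jE V·ξ₀|·|cA| = |jEϖ|^b ∧ ∃ e ∈ Fix ρ, eΘe = κ̂ρκ̂∕(hρh)` — ★ F1's `hC` for the lower
line at `|γ₁| = 1` (`|γ₁(V′ − V)| ≤ e^{−2(d−1)} = |ϖ|^{2d−2}`). [cite: Serre1979, Ch. V §3 Cor. 3 pp. 85–87] [cite: Rogawski1990, §4.9 Prop. 4.9.1 (b) p. 55] [cite: Kottwitz1986BaseChangeUnits, §3] -/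
theorem litStar_iff_of_near_of_big {σ : E →+* E} {ϖ : E} {d : ℕ}
    (jE : E →+* M) (hjiso : ∀ a, Valued.v (jE a) = Valued.v a) (hjfix : ∀ z, ρ z = z ↔ ∃ c, jE c = z) (hΘj : ∀ c, Θ (jE c) = jE (σ c))
    (hρρ : ∀ x, ρ (ρ x) = x) (hvρ : ∀ x, Valued.v (ρ x) = Valued.v x) (hΘρ : ∀ x, Θ (ρ x) = ρ (Θ x))
    {κ₀ ξ₀ : M} (hκ₀ : κ₀ + ρ κ₀ = 1) (hΘκ₀ : Θ κ₀ = κ₀) (hξ : ρ ξ₀ = -ξ₀) (hΘξ : Θ ξ₀ = ξ₀) (hξ0 : ξ₀ ≠ 0)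
    {cA hM : M} {b : ℕ} (hRe : Valued.v ξ₀ * Valued.v cA = Valued.v (jE ϖ) ^ b) (hϖ0 : jE ϖ ≠ 0)
    (hdeep : ∀ u : M, ρ u = u → Θ u = u → Valued.v (u - 1) ≤ Valued.v (jE ϖ) ^ (2 * d - 1) → ∃ c : M, ρ c = c ∧ c * Θ c = u)
    (hbig : 1 ≤ Valued.v (jE ϖ) * Valued.v ξ₀) (h2 : Valued.v (2 : M) ≤ Valued.v (jE ϖ)) (hd2 : 2 ≤ d) (hϖlt : Valued.v ϖ < 1)
    {V V' : E} (hσV : σ V = V) (hσV' : σ V' = V') (hnear : Valued.v (V' - V) ≤ Valued.v ϖ ^ (2 * d - 2)) :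
    (Valued.v (κ₀ + jE V * ξ₀) * Valued.v cA = Valued.v (jE ϖ) ^ b ∧
        ∃ e : M, ρ e = e ∧ e * Θ e = (κ₀ + jE V * ξ₀) * ρ (κ₀ + jE V * ξ₀) / (hM * ρ hM)) ↔
      (Valued.v (κ₀ + jE V' * ξ₀) * Valued.v cA = Valued.v (jE ϖ) ^ b ∧
        ∃ e : M, ρ e = e ∧ e * Θ e = (κ₀ + jE V' * ξ₀) * ρ (κ₀ + jE V' * ξ₀) / (hM * ρ hM)) := by
  have hnear' : Valued.v (V - V') ≤ Valued.v ϖ ^ (2 * d - 2) := by rw [← neg_sub, Valuation.map_neg]; exact hnear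
  exact ⟨litStar_of_near_of_big jE hjiso hjfix hΘj hρρ hvρ hΘρ hκ₀ hΘκ₀ hξ hΘξ hξ0 hRe hϖ0 hdeep hbig h2 hd2 hϖlt hσV hσV' hnear,
    litStar_of_near_of_big jE hjiso hjfix hΘj hρρ hvρ hΘρ hκ₀ hΘκ₀ hξ hΘξ hξ0 hRe hϖ0 hdeep hbig h2 hd2 hϖlt hσV' hσV hnear'⟩

end Summit.HodgeConjecture.HodgeConjecture.Cruxes.H413.F0P3cDyRamLowerLineDigitConstancy

end
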